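import Mathlib.Analysis.Distribution.SchwartzSpace.Fourier
import Mathlib.Analysis.Distribution.AEEqOfIntegralContDiff
import HarnessLib

/-!
# Uniqueness (injectivity) of the Fourier transform on `L¹`

Trunk T-ANALYSIS support (`Literature/Analysis/Fourier`): the classical uniqueness theorem for
the Fourier transform of integrable functions on a finite-dimensional real inner product space
`V`: if `f ∈ L¹(V, E)` and `𝓕 f = 0` everywhere, then `f = 0` almost everywhere; hence two
integrable functions with the same Fourier transform agree almost everywhere.

Mathlib has the inversion formula at continuity points (`MeasureTheory.Integrable.fourierInv_fourier_eq`,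
which needs `𝓕 f ∈ L¹` *and* continuity of `f` at the point) and the injectivity of
`Lᵖ → 𝓢'` (`MeasureTheory.Lp.ker_toTemperedDistributionCLM_eq_bot`), but not the plain `L¹`
uniqueness statement for a merely integrable `f`; this file supplies it.

## Proof

Duality: for a Schwartz function `φ` and `f ∈ L¹`, `∫ 𝓕φ • f = ∫ φ • 𝓕f`
(`VectorFourier.integral_fourierIntegral_smul_eq_flip`). If `𝓕 f = 0` then `∫ ψ • f = 0` for
every Schwartz `ψ = 𝓕(𝓕⁻ψ)`, in particular for every smooth compactly supported `ψ`, and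
`ae_eq_zero_of_integral_contDiff_smul_eq_zero` concludes.

## Contents (all proved)

* `Literature.Analysis.Fourier.integral_fourier_smul_eq_of_integrable` — duality `∫ 𝓕φ • f = ∫ φ • 𝓕f`
  for `φ` Schwartz, `f` integrable.
* `Literature.Analysis.Fourier.ae_eq_zero_of_forall_fourier_eq_zero` — `f ∈ L¹`, `𝓕 f = 0` ⇒ `f = 0` a.e.
* `Literature.Analysis.Fourier.forall_fourier_eq_zero_iff` — `𝓕 f = 0 ↔ f = 0` a.e.
* `Literature.Analysis.Fourier.ae_eq_of_fourier_eq` — `f, g ∈ L¹`, `𝓕 f = 𝓕 g` ⇒ `f = g` a.e.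

## References

* Y. Katznelson, *An introduction to harmonic analysis*, 3rd ed., Cambridge 2004, Ch. VI §1.11,
  Corollary (uniqueness theorem): "If `f ∈ L¹(ℝ)` and `f̂(ξ) = 0` for all `ξ` then `f = 0`"
  (printed for `ℝ`, via Fejér summability; the duality proof below works verbatim on any
  finite-dimensional real inner product space).
* E. M. Stein, G. Weiss, *Introduction to Fourier analysis on Euclidean spaces*, Princeton 1971,
  Ch. I §1 (the `ℝⁿ` statement).
-/

noncomputable section

open MeasureTheory SchwartzMap FourierTransform
open scoped ContDiff

namespace Literature.Analysis.Fourier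

variable {V : Type*} [NormedAddCommGroup V] [InnerProductSpace ℝ V] [FiniteDimensional ℝ V]
  [MeasurableSpace V] [BorelSpace V]
  {E : Type*} [NormedAddCommGroup E] [NormedSpace ℂ E] [CompleteSpace E]

/-- **Duality between Schwartz functions and `L¹`.** For a Schwartz function `φ` and an
integrable `f`, `∫ 𝓕φ(ξ) • f(ξ) dξ = ∫ φ(x) • 𝓕f(x) dx` (Fubini). [folklore] -/
theorem integral_fourier_smul_eq_of_integrable (φ : 𝓢(V, ℂ)) {f : V → E} (hf : Integrable f) :
    ∫ ξ, 𝓕 (φ : V → ℂ) ξ • f ξ = ∫ x, φ x • 𝓕 f x := by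
  simpa using! VectorFourier.integral_fourierIntegral_smul_eq_flip (L := innerₗ V)
    Real.continuous_fourierChar continuous_inner φ.integrable hf

/-- **Uniqueness theorem for the Fourier transform on `L¹`.** If `f` is integrable and its
Fourier transform vanishes identically, then `f = 0` almost everywhere (Katznelson states it on
`ℝ`; proved here on any finite-dimensional real inner product space).
[cite: Katznelson2004, Ch. VI §1.11 Corollary] -/
theorem ae_eq_zero_of_forall_fourier_eq_zero {f : V → E} (hf : Integrable f)
    (h : ∀ w : V, 𝓕 f w = 0) : f =ᵐ[volume] 0 := by
  refine ae_eq_zero_of_integral_contDiff_smul_eq_zero hf.locallyIntegrable fun g hg hgc ↦ ?_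
  have hg₁ : HasCompactSupport fun x ↦ (g x : ℂ) := hgc.comp_left Complex.ofReal_zero
  have hg₂ : ContDiff ℝ ∞ fun x ↦ (g x : ℂ) := Complex.ofRealCLM.contDiff.comp hg
  set ψ : 𝓢(V, ℂ) := hg₁.toSchwartzMap hg₂ with hψ
  have hFψ : 𝓕 ((𝓕⁻ ψ : 𝓢(V, ℂ)) : V → ℂ) = (ψ : V → ℂ) := by
    rw [← SchwartzMap.fourier_coe, fourier_fourierInv_eq]
  have key := integral_fourier_smul_eq_of_integrable (𝓕⁻ ψ : 𝓢(V, ℂ)) hf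
  rw [hFψ] at key
  -- `g x • f x = (g x : ℂ) • f x = ψ x • f x` definitionally (`Module.complexToReal`)
  calc ∫ x, g x • f x = ∫ x, (ψ : V → ℂ) x • f x := rfl
    _ = ∫ x, (𝓕⁻ ψ : 𝓢(V, ℂ)) x • 𝓕 f x := key
    _ = 0 := by simp [h]

/-- The Fourier transform of an integrable `f` vanishes identically iff `f = 0` a.e. [folklore] -/
theorem forall_fourier_eq_zero_iff {f : V → E} (hf : Integrable f) :
    (∀ w : V, 𝓕 f w = 0) ↔ f =ᵐ[volume] 0 := by
  refine ⟨ae_eq_zero_of_forall_fourier_eq_zero hf, fun h w ↦ ?_⟩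
  rw [Real.fourier_congr_ae h]
  simp [Real.fourier_eq]

/-- **Injectivity of the Fourier transform on `L¹`**: two integrable functions with the same
Fourier transform agree almost everywhere. [cite: Katznelson2004, Ch. VI §1.11 Corollary] -/
theorem ae_eq_of_fourier_eq {f g : V → E} (hf : Integrable f) (hg : Integrable g)
    (h : 𝓕 f = 𝓕 g) : f =ᵐ[volume] g := by
  have h0 : ∀ w : V, 𝓕 (f - g) w = 0 := fun w ↦ by
    have : 𝓕 (f - g) w = 𝓕 f w - 𝓕 g w := by
      simp only [Real.fourier_eq, Pi.sub_apply, smul_sub]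
      exact integral_sub ((Real.fourierIntegral_convergent_iff w).2 hf)
        ((Real.fourierIntegral_convergent_iff w).2 hg)
    rw [this, h, sub_self]
  have := ae_eq_zero_of_forall_fourier_eq_zero (hf.sub hg) h0
  filter_upwards [this] with x hx
  exact sub_eq_zero.1 hx

end Literature.Analysis.Fourier
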